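import Mathlib
import HarnessLib
import Summits.Ventures.LatticeQCDFlow.Scoring.GeometricEnvelopeBlockSumMoments

/-!
# The long-run CROSS-covariance `σ_{fg} = ∫ f̄ ḡ dπ + Σ_{k≥1} (∫ f̄ K^k ḡ dπ + ∫ ḡ K^k f̄ dπ)` of two
# observables: bilinearity of the Green–Kubo variance, polarization, and `σ_{fg}² ≤ σ²_f σ²_g`

HONEST FRAMING: exact (Metropolis-corrected) sampling algorithms for lattice gauge theory;
figures of merit are autocorrelation/cost numbers at stated couplings and volumes; no
continuum-physics claim.

Venture `LatticeQCDFlow` (cell pub-lqcd), topic `Scoring`; FANOUT row 8 (`s0-cpn-nemc`, GEN-22).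
NEW WORK of the cell, not a published result; no definition is introduced; nothing is cited as a
fact.  Every derived column of a run card is a function of SEVERAL chain averages (a ratio of two
means, an effective sample size, a free-energy difference), so its error bar needs the joint
long-run covariance of the averages, not only the Green–Kubo variances
`σ²_h = ∫ h̄² dπ + 2 Σ' k, ∫ h̄ (kop κ)^[k+1] h̄ dπ` (`h̄ = h − πh`) of the single observables.  For two
bounded measurable observables `f, g` write `c^{fg}_k = ∫ f̄ (kop κ)^[k] ḡ dπ` and
`σ_{fg} = ∫ f̄ ḡ dπ + Σ' k, (c^{fg}_{k+1} + c^{gf}_{k+1})` (the sum over all integer lags of the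
stationary cross-covariances `Cov_π(f(X₀), g(X_k))`).  This file proves, whenever the four series
`Σ c^{ff}_{k+1}`, `Σ c^{gg}_{k+1}`, `Σ c^{fg}_{k+1}`, `Σ c^{gf}_{k+1}` converge: the Green–Kubo variance is
a QUADRATIC FORM, `σ²_{uf+vg} = u² σ²_f + 2uv σ_{fg} + v² σ²_g` (all reals `u, v`), hence the
POLARIZATION identity `σ_{fg} = ¼ (σ²_{f+g} − σ²_{f−g})`; and, under the geometric sup-norm envelope
`|(kop κ)^[t] g − πg| ≤ 2 C_g A ρ^t` (`0 ≤ ρ < 1`; every kernel with a Doeblin power) with `π`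
invariant: the four series converge absolutely (`|c^{fg}_k| ≤ 8 C_f C_g A ρ^k`), and since
`σ²_{uf+g} ≥ 0` for every `u` (`greenKubo_nonneg_of_envelope`) the long-run covariance matrix is
positive semidefinite: `σ_{fg}² ≤ σ²_f σ²_g`.  Printed counterparts NAMED ONLY: multivariate
(batch-means / spectral) estimation of the long-run covariance matrix of a Markov chain (Hannan
1970; Vats–Flegal–Jones 2019), nothing cited as a fact.

## Content (`h̄ = h − πh`; `c^{fg}_k = ∫ f̄ (kop κ)^[k] ḡ dπ`; `σ_{fg}` as above)

* `iterate_kop_lincomb` — `(kop κ)^[t] (u f + v g) = u (kop κ)^[t] f + v (kop κ)^[t] g`;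
* **`greenKubo_lincomb_eq`** — `σ²_{uf+vg} = u² σ²_f + 2uv σ_{fg} + v² σ²_g` (four summabilities);
  **`greenKuboCross_eq_polarization`** — `¼ (σ²_{f+g} − σ²_{f−g}) = σ_{fg}`;
* `abs_crossAutocov_le_of_envelope`, `summable_crossAutocov_of_envelope`,
  `greenKubo_lincomb_eq_of_envelope`, `greenKuboCross_eq_polarization_of_envelope`;
* **`greenKuboCross_sq_le_of_envelope`** — `σ_{fg}² ≤ σ²_f σ²_g` (`π` invariant, `0 ≤ ρ < 1`).

NOT CLAIMED: anything about a concrete sampler; unbounded observables; any number of ours.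
-/

noncomputable section

namespace Summit.Ventures.LatticeQCDFlow.Scoring

open MeasureTheory ProbabilityTheory Filter Finset Preorder
open scoped ENNReal Topology

variable {Ω : Type*} [MeasurableSpace Ω]

/-! ### Linearity of the iterated transition operator -/

section Operator

variable (κ : Kernel Ω Ω) [IsMarkovKernel κ]

/-- **`(kop κ)^[t] (u f + v g) = u (kop κ)^[t] f + v (kop κ)^[t] g`** for bounded measurable `f, g`
and reals `u, v` (induction on `t`; `integral_add` at each step). -/
theorem iterate_kop_lincomb {f g : Ω → ℝ} (hf : Measurable f) (hg : Measurable g) {Cf Cg : ℝ}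
    (hCf : ∀ x, |f x| ≤ Cf) (hCg : ∀ x, |g x| ≤ Cg) (u v : ℝ) :
    ∀ t : ℕ, (kop κ)^[t] (fun x => u * f x + v * g x)
      = fun x => u * (kop κ)^[t] f x + v * (kop κ)^[t] g x := by
  intro t
  induction t with
  | zero => rfl
  | succ t ih =>
    obtain ⟨hfm, hfb⟩ := iterate_kop_bounded_measurable κ hf hCf t
    obtain ⟨hgm, hgb⟩ := iterate_kop_bounded_measurable κ hg hCg t
    rw [Function.iterate_succ_apply', ih, Function.iterate_succ_apply', Function.iterate_succ_apply']
    funext x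
    show ∫ y, (u * (kop κ)^[t] f y + v * (kop κ)^[t] g y) ∂(κ x)
      = u * ∫ y, (kop κ)^[t] f y ∂(κ x) + v * ∫ y, (kop κ)^[t] g y ∂(κ x)
    rw [integral_add ((integrable_of_bounded _ hfm hfb).const_mul u)
      ((integrable_of_bounded _ hgm hgb).const_mul v), integral_const_mul, integral_const_mul]

end Operator

/-- The product of two bounded measurable observables is integrable against a finite measure. -/
private theorem integrable_mul_of_abs_le (μ : Measure Ω) [IsFiniteMeasure μ] {u w : Ω → ℝ}
    (hu : Measurable u) (hw : Measurable w) {Cu Cw : ℝ} (hCu : ∀ x, |u x| ≤ Cu)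
    (hCw : ∀ x, |w x| ≤ Cw) : Integrable (fun x => u x * w x) μ := by
  refine integrable_of_bounded μ (hu.mul hw) (C := |Cu| * Cw) fun x => ?_
  rw [abs_mul]
  exact mul_le_mul ((hCu x).trans (le_abs_self _)) (hCw x) (abs_nonneg _) (abs_nonneg _)

/-! ### The Green–Kubo variance is a quadratic form; polarization -/

section Bilinear

variable (κ : Kernel Ω Ω) [IsMarkovKernel κ] (π : Measure Ω) [IsProbabilityMeasure π]

/-- **BILINEARITY.**  For bounded measurable `f, g`, reals `u, v`, and the four lag series
`Σ c^{ff}_{k+1}`, `Σ c^{gg}_{k+1}`, `Σ c^{fg}_{k+1}`, `Σ c^{gf}_{k+1}` summable: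
`σ²_{uf+vg} = u² σ²_f + 2 u v σ_{fg} + v² σ²_g`, with
`σ_{fg} = ∫ f̄ ḡ dπ + Σ' k, (c^{fg}_{k+1} + c^{gf}_{k+1})`. -/
theorem greenKubo_lincomb_eq {f g : Ω → ℝ} (hf : Measurable f) (hg : Measurable g) {Cf Cg : ℝ}
    (hCf : ∀ x, |f x| ≤ Cf) (hCg : ∀ x, |g x| ≤ Cg)
    (hsff : Summable fun k : ℕ =>
      ∫ y, (f y - ∫ z, f z ∂π) * (kop κ)^[k + 1] (fun y => f y - ∫ z, f z ∂π) y ∂π)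
    (hsgg : Summable fun k : ℕ =>
      ∫ y, (g y - ∫ z, g z ∂π) * (kop κ)^[k + 1] (fun y => g y - ∫ z, g z ∂π) y ∂π)
    (hsfg : Summable fun k : ℕ =>
      ∫ y, (f y - ∫ z, f z ∂π) * (kop κ)^[k + 1] (fun y => g y - ∫ z, g z ∂π) y ∂π)
    (hsgf : Summable fun k : ℕ =>
      ∫ y, (g y - ∫ z, g z ∂π) * (kop κ)^[k + 1] (fun y => f y - ∫ z, f z ∂π) y ∂π) (u v : ℝ) :
    (∫ y, ((u * f y + v * g y) - ∫ z, (u * f z + v * g z) ∂π) ^ 2 ∂π)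
        + 2 * ∑' k, ∫ y, ((u * f y + v * g y) - ∫ z, (u * f z + v * g z) ∂π)
          * (kop κ)^[k + 1] (fun y => (u * f y + v * g y) - ∫ z, (u * f z + v * g z) ∂π) y ∂π
      = u ^ 2 * ((∫ y, (f y - ∫ z, f z ∂π) ^ 2 ∂π)
            + 2 * ∑' k, ∫ y, (f y - ∫ z, f z ∂π) * (kop κ)^[k + 1] (fun y => f y - ∫ z, f z ∂π) y ∂π)
        + 2 * (u * v) * ((∫ y, (f y - ∫ z, f z ∂π) * (g y - ∫ z, g z ∂π) ∂π)
            + ∑' k, ((∫ y, (f y - ∫ z, f z ∂π) * (kop κ)^[k + 1] (fun y => g y - ∫ z, g z ∂π) y ∂π)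
              + ∫ y, (g y - ∫ z, g z ∂π) * (kop κ)^[k + 1] (fun y => f y - ∫ z, f z ∂π) y ∂π))
        + v ^ 2 * ((∫ y, (g y - ∫ z, g z ∂π) ^ 2 ∂π)
            + 2 * ∑' k, ∫ y, (g y - ∫ z, g z ∂π)
              * (kop κ)^[k + 1] (fun y => g y - ∫ z, g z ∂π) y ∂π) := by
  set cf := ∫ z, f z ∂π with hcf
  set cg := ∫ z, g z ∂π with hcg
  obtain ⟨hfb, hCfb, -⟩ := centred_observable_bounds π hf hCf
  obtain ⟨hgb, hCgb, -⟩ := centred_observable_bounds π hg hCg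
  rw [← hcf] at hfb hCfb
  rw [← hcg] at hgb hCgb
  -- the mean and the centring of the combination
  have hch : ∫ z, (u * f z + v * g z) ∂π = u * cf + v * cg := by
    rw [integral_add ((integrable_of_bounded π hf hCf).const_mul u)
      ((integrable_of_bounded π hg hCg).const_mul v), integral_const_mul, integral_const_mul]
  have hfun : (fun y => (u * f y + v * g y) - ∫ z, (u * f z + v * g z) ∂π)
      = fun y => u * (f y - cf) + v * (g y - cg) := by
    funext y; rw [hch]; ring
  -- the iterates of the centred combination
  have hK : ∀ k, (kop κ)^[k] (fun y => (u * f y + v * g y) - ∫ z, (u * f z + v * g z) ∂π)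
      = fun y => u * (kop κ)^[k] (fun y => f y - cf) y + v * (kop κ)^[k] (fun y => g y - cg) y := by
    intro k
    rw [hfun]
    exact iterate_kop_lincomb κ hfb hgb hCfb hCgb u v k
  -- names for the four lag-`k+1` integrands' factors
  have hAm : ∀ k, Measurable ((kop κ)^[k + 1] (fun y => f y - cf)) ∧
      ∀ x, |(kop κ)^[k + 1] (fun y => f y - cf) x| ≤ 2 * Cf := fun k =>
    iterate_kop_bounded_measurable κ hfb hCfb (k + 1)
  have hBm : ∀ k, Measurable ((kop κ)^[k + 1] (fun y => g y - cg)) ∧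
      ∀ x, |(kop κ)^[k + 1] (fun y => g y - cg) x| ≤ 2 * Cg := fun k =>
    iterate_kop_bounded_measurable κ hgb hCgb (k + 1)
  -- the lag-zero term
  have h0 : ∫ y, ((u * f y + v * g y) - ∫ z, (u * f z + v * g z) ∂π) ^ 2 ∂π
      = u ^ 2 * ∫ y, (f y - cf) ^ 2 ∂π + 2 * (u * v) * ∫ y, (f y - cf) * (g y - cg) ∂π
        + v ^ 2 * ∫ y, (g y - cg) ^ 2 ∂π := by
    have e : ∀ y, ((u * f y + v * g y) - ∫ z, (u * f z + v * g z) ∂π) ^ 2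
        = u ^ 2 * (f y - cf) ^ 2 + 2 * (u * v) * ((f y - cf) * (g y - cg))
          + v ^ 2 * (g y - cg) ^ 2 := by
      intro y; rw [hch]; ring
    have hi1 : Integrable (fun y => (f y - cf) ^ 2) π := by
      have := integrable_mul_of_abs_le π hfb hfb hCfb hCfb
      exact this.congr (ae_of_all _ fun y => by ring)
    have hi2 : Integrable (fun y => (f y - cf) * (g y - cg)) π :=
      integrable_mul_of_abs_le π hfb hgb hCfb hCgb
    have hi3 : Integrable (fun y => (g y - cg) ^ 2) π := by
      have := integrable_mul_of_abs_le π hgb hgb hCgb hCgb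
      exact this.congr (ae_of_all _ fun y => by ring)
    have hi12 : Integrable (fun y => u ^ 2 * (f y - cf) ^ 2
        + 2 * (u * v) * ((f y - cf) * (g y - cg))) π := (hi1.const_mul _).add (hi2.const_mul _)
    rw [integral_congr_ae (ae_of_all _ e), integral_add hi12 (hi3.const_mul _),
      integral_add (hi1.const_mul _) (hi2.const_mul _), integral_const_mul, integral_const_mul,
      integral_const_mul]
  -- the lag-`k+1` terms
  have hk : ∀ k : ℕ, ∫ y, ((u * f y + v * g y) - ∫ z, (u * f z + v * g z) ∂π)
        * (kop κ)^[k + 1] (fun y => (u * f y + v * g y) - ∫ z, (u * f z + v * g z) ∂π) y ∂π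
      = u ^ 2 * ∫ y, (f y - cf) * (kop κ)^[k + 1] (fun y => f y - cf) y ∂π
        + (u * v) * ((∫ y, (f y - cf) * (kop κ)^[k + 1] (fun y => g y - cg) y ∂π)
          + ∫ y, (g y - cg) * (kop κ)^[k + 1] (fun y => f y - cf) y ∂π)
        + v ^ 2 * ∫ y, (g y - cg) * (kop κ)^[k + 1] (fun y => g y - cg) y ∂π := by
    intro k
    obtain ⟨hA, hCA⟩ := hAm k
    obtain ⟨hB, hCB⟩ := hBm k
    rw [hK (k + 1)]
    have e : ∀ y, ((u * f y + v * g y) - ∫ z, (u * f z + v * g z) ∂π)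
          * (fun y => u * (kop κ)^[k + 1] (fun y => f y - cf) y
              + v * (kop κ)^[k + 1] (fun y => g y - cg) y) y
        = u ^ 2 * ((f y - cf) * (kop κ)^[k + 1] (fun y => f y - cf) y)
          + (u * v) * ((f y - cf) * (kop κ)^[k + 1] (fun y => g y - cg) y
              + (g y - cg) * (kop κ)^[k + 1] (fun y => f y - cf) y)
          + v ^ 2 * ((g y - cg) * (kop κ)^[k + 1] (fun y => g y - cg) y) := by
      intro y; simp only []; rw [hch]; ring
    have hi1 := integrable_mul_of_abs_le π hfb hA hCfb hCA
    have hi2 := integrable_mul_of_abs_le π hfb hB hCfb hCB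
    have hi3 := integrable_mul_of_abs_le π hgb hA hCgb hCA
    have hi4 := integrable_mul_of_abs_le π hgb hB hCgb hCB
    have hi23 : Integrable (fun y => (f y - cf) * (kop κ)^[k + 1] (fun y => g y - cg) y
        + (g y - cg) * (kop κ)^[k + 1] (fun y => f y - cf) y) π := hi2.add hi3
    have hi123 : Integrable (fun y => u ^ 2 * ((f y - cf) * (kop κ)^[k + 1] (fun y => f y - cf) y)
        + (u * v) * ((f y - cf) * (kop κ)^[k + 1] (fun y => g y - cg) y
          + (g y - cg) * (kop κ)^[k + 1] (fun y => f y - cf) y)) π :=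
      (hi1.const_mul _).add (hi23.const_mul _)
    rw [integral_congr_ae (ae_of_all _ e), integral_add hi123 (hi4.const_mul _),
      integral_add (hi1.const_mul _) (hi23.const_mul _), integral_const_mul,
      integral_const_mul, integral_const_mul, integral_add hi2 hi3]
  -- sum the series termwise
  have hser : ∑' k, ∫ y, ((u * f y + v * g y) - ∫ z, (u * f z + v * g z) ∂π)
        * (kop κ)^[k + 1] (fun y => (u * f y + v * g y) - ∫ z, (u * f z + v * g z) ∂π) y ∂π
      = u ^ 2 * ∑' k, ∫ y, (f y - cf) * (kop κ)^[k + 1] (fun y => f y - cf) y ∂π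
        + (u * v) * ∑' k, ((∫ y, (f y - cf) * (kop κ)^[k + 1] (fun y => g y - cg) y ∂π)
          + ∫ y, (g y - cg) * (kop κ)^[k + 1] (fun y => f y - cf) y ∂π)
        + v ^ 2 * ∑' k, ∫ y, (g y - cg) * (kop κ)^[k + 1] (fun y => g y - cg) y ∂π := by
    have hs23 : Summable fun k : ℕ =>
        (∫ y, (f y - cf) * (kop κ)^[k + 1] (fun y => g y - cg) y ∂π)
          + ∫ y, (g y - cg) * (kop κ)^[k + 1] (fun y => f y - cf) y ∂π := hsfg.add hsgf
    have hs1 : Summable fun k : ℕ =>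
        u ^ 2 * ∫ y, (f y - cf) * (kop κ)^[k + 1] (fun y => f y - cf) y ∂π := hsff.mul_left _
    have hs2 : Summable fun k : ℕ => (u * v)
        * ((∫ y, (f y - cf) * (kop κ)^[k + 1] (fun y => g y - cg) y ∂π)
          + ∫ y, (g y - cg) * (kop κ)^[k + 1] (fun y => f y - cf) y ∂π) := hs23.mul_left _
    have hs3 : Summable fun k : ℕ =>
        v ^ 2 * ∫ y, (g y - cg) * (kop κ)^[k + 1] (fun y => g y - cg) y ∂π := hsgg.mul_left _
    have hs12 : Summable fun k : ℕ =>
        u ^ 2 * ∫ y, (f y - cf) * (kop κ)^[k + 1] (fun y => f y - cf) y ∂π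
        + (u * v) * ((∫ y, (f y - cf) * (kop κ)^[k + 1] (fun y => g y - cg) y ∂π)
          + ∫ y, (g y - cg) * (kop κ)^[k + 1] (fun y => f y - cf) y ∂π) := hs1.add hs2
    rw [tsum_congr hk, hs12.tsum_add hs3, hs1.tsum_add hs2, tsum_mul_left, tsum_mul_left,
      tsum_mul_left]
  rw [h0, hser]
  ring

/-- **POLARIZATION.**  Same hypotheses: `¼ (σ²_{f+g} − σ²_{f−g}) = σ_{fg}`. -/
theorem greenKuboCross_eq_polarization {f g : Ω → ℝ} (hf : Measurable f) (hg : Measurable g)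
    {Cf Cg : ℝ} (hCf : ∀ x, |f x| ≤ Cf) (hCg : ∀ x, |g x| ≤ Cg)
    (hsff : Summable fun k : ℕ =>
      ∫ y, (f y - ∫ z, f z ∂π) * (kop κ)^[k + 1] (fun y => f y - ∫ z, f z ∂π) y ∂π)
    (hsgg : Summable fun k : ℕ =>
      ∫ y, (g y - ∫ z, g z ∂π) * (kop κ)^[k + 1] (fun y => g y - ∫ z, g z ∂π) y ∂π)
    (hsfg : Summable fun k : ℕ =>
      ∫ y, (f y - ∫ z, f z ∂π) * (kop κ)^[k + 1] (fun y => g y - ∫ z, g z ∂π) y ∂π)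
    (hsgf : Summable fun k : ℕ =>
      ∫ y, (g y - ∫ z, g z ∂π) * (kop κ)^[k + 1] (fun y => f y - ∫ z, f z ∂π) y ∂π) :
    (1 / 4 : ℝ) * (((∫ y, ((f y + g y) - ∫ z, (f z + g z) ∂π) ^ 2 ∂π)
          + 2 * ∑' k, ∫ y, ((f y + g y) - ∫ z, (f z + g z) ∂π)
            * (kop κ)^[k + 1] (fun y => (f y + g y) - ∫ z, (f z + g z) ∂π) y ∂π)
        - ((∫ y, ((f y - g y) - ∫ z, (f z - g z) ∂π) ^ 2 ∂π)
          + 2 * ∑' k, ∫ y, ((f y - g y) - ∫ z, (f z - g z) ∂π)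
            * (kop κ)^[k + 1] (fun y => (f y - g y) - ∫ z, (f z - g z) ∂π) y ∂π))
      = (∫ y, (f y - ∫ z, f z ∂π) * (g y - ∫ z, g z ∂π) ∂π)
        + ∑' k, ((∫ y, (f y - ∫ z, f z ∂π) * (kop κ)^[k + 1] (fun y => g y - ∫ z, g z ∂π) y ∂π)
          + ∫ y, (g y - ∫ z, g z ∂π) * (kop κ)^[k + 1] (fun y => f y - ∫ z, f z ∂π) y ∂π) := by
  have hp := greenKubo_lincomb_eq κ π hf hg hCf hCg hsff hsgg hsfg hsgf 1 1
  have hm := greenKubo_lincomb_eq κ π hf hg hCf hCg hsff hsgg hsfg hsgf 1 (-1)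
  simp only [one_mul, neg_one_mul, ← sub_eq_add_neg] at hp hm
  rw [hp, hm]
  ring

end Bilinear

/-! ### Under the geometric envelope: absolute convergence and `σ_{fg}² ≤ σ²_f σ²_g` -/

section Envelope

variable {κ : Kernel Ω Ω} [IsMarkovKernel κ] {π : Measure Ω} [IsProbabilityMeasure π] {A ρ : ℝ}

omit [IsMarkovKernel κ] in
/-- **`|c^{fg}_k| ≤ 8 C_f C_g A ρ^k`**: under the envelope the stationary cross second moment
`∫ f̄ (kop κ)^[k] ḡ dπ` of two centred bounded observables decays geometrically (`|f̄| ≤ 2C_f`,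
`|(kop κ)^[k] ḡ| ≤ 2 (2C_g) A ρ^k`). -/
theorem abs_crossAutocov_le_of_envelope
    (henv : ∀ (g : Ω → ℝ), Measurable g → ∀ (Cg : ℝ), (∀ x, |g x| ≤ Cg) →
      ∀ (t : ℕ) (x : Ω), |(kop κ)^[t] g x - ∫ y, g y ∂π| ≤ 2 * Cg * (A * ρ ^ t))
    {f g : Ω → ℝ} (hf : Measurable f) (hg : Measurable g) {Cf Cg : ℝ} (hCf : ∀ x, |f x| ≤ Cf)
    (hCg : ∀ x, |g x| ≤ Cg) (k : ℕ) :
    |∫ y, (f y - ∫ z, f z ∂π) * (kop κ)^[k] (fun y => g y - ∫ z, g z ∂π) y ∂π|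
      ≤ 8 * Cf * Cg * (A * ρ ^ k) := by
  obtain ⟨hfb, hCfb, -⟩ := centred_observable_bounds π hf hCf
  obtain ⟨hgb, hCgb, hgb0⟩ := centred_observable_bounds π hg hCg
  have hdec : ∀ x, |(kop κ)^[k] (fun y => g y - ∫ z, g z ∂π) x| ≤ 2 * (2 * Cg) * (A * ρ ^ k) :=
    decay_of_geometricEnvelope henv _ hgb (2 * Cg) hCgb hgb0 k
  have hi : Integrable (fun y => |f y - ∫ z, f z ∂π| * (2 * (2 * Cg) * (A * ρ ^ k))) π :=
    ((integrable_of_bounded π hfb hCfb).abs.mul_const _)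
  calc |∫ y, (f y - ∫ z, f z ∂π) * (kop κ)^[k] (fun y => g y - ∫ z, g z ∂π) y ∂π|
      = ‖∫ y, (f y - ∫ z, f z ∂π) * (kop κ)^[k] (fun y => g y - ∫ z, g z ∂π) y ∂π‖ :=
        (Real.norm_eq_abs _).symm
    _ ≤ ∫ y, ‖(f y - ∫ z, f z ∂π) * (kop κ)^[k] (fun y => g y - ∫ z, g z ∂π) y‖ ∂π :=
        norm_integral_le_integral_norm _
    _ ≤ ∫ y, |f y - ∫ z, f z ∂π| * (2 * (2 * Cg) * (A * ρ ^ k)) ∂π := by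
        refine integral_mono_of_nonneg (ae_of_all _ fun y => norm_nonneg _) hi
          (ae_of_all _ fun y => ?_)
        show ‖(f y - ∫ z, f z ∂π) * (kop κ)^[k] (fun y => g y - ∫ z, g z ∂π) y‖
          ≤ |f y - ∫ z, f z ∂π| * (2 * (2 * Cg) * (A * ρ ^ k))
        rw [Real.norm_eq_abs, abs_mul]
        exact mul_le_mul_of_nonneg_left (hdec y) (abs_nonneg _)
    _ ≤ ∫ y, (2 * Cf) * (2 * (2 * Cg) * (A * ρ ^ k)) ∂π := by
        refine integral_mono_of_nonneg (ae_of_all _ fun y => mul_nonneg (abs_nonneg _)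
          ((abs_nonneg _).trans (hdec y))) (integrable_const _) (ae_of_all _ fun y => ?_)
        exact mul_le_mul_of_nonneg_right (hCfb y) ((abs_nonneg _).trans (hdec y))
    _ = 8 * Cf * Cg * (A * ρ ^ k) := by rw [integral_const, probReal_univ, one_smul]; ring

omit [IsMarkovKernel κ] in
/-- **The cross lag series converges** under the envelope (`0 ≤ ρ < 1`):
`Summable (k ↦ c^{fg}_{k+1})`. -/
theorem summable_crossAutocov_of_envelope
    (henv : ∀ (g : Ω → ℝ), Measurable g → ∀ (Cg : ℝ), (∀ x, |g x| ≤ Cg) →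
      ∀ (t : ℕ) (x : Ω), |(kop κ)^[t] g x - ∫ y, g y ∂π| ≤ 2 * Cg * (A * ρ ^ t))
    (hρ0 : 0 ≤ ρ) (hρ1 : ρ < 1) {f g : Ω → ℝ} (hf : Measurable f) (hg : Measurable g)
    {Cf Cg : ℝ} (hCf : ∀ x, |f x| ≤ Cf) (hCg : ∀ x, |g x| ≤ Cg) :
    Summable fun k : ℕ =>
      ∫ y, (f y - ∫ z, f z ∂π) * (kop κ)^[k + 1] (fun y => g y - ∫ z, g z ∂π) y ∂π := by
  refine Summable.of_norm_bounded ((((summable_geometric_of_lt_one hρ0 hρ1).mul_left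
    (A * ρ)).mul_left (8 * Cf * Cg))) fun k => ?_
  rw [Real.norm_eq_abs]
  refine (abs_crossAutocov_le_of_envelope henv hf hg hCf hCg (k + 1)).trans (le_of_eq ?_)
  rw [pow_succ]; ring

/-- **BILINEARITY under the envelope** (no summability hypothesis left):
`σ²_{uf+vg} = u² σ²_f + 2uv σ_{fg} + v² σ²_g`. -/
theorem greenKubo_lincomb_eq_of_envelope
    (henv : ∀ (g : Ω → ℝ), Measurable g → ∀ (Cg : ℝ), (∀ x, |g x| ≤ Cg) →
      ∀ (t : ℕ) (x : Ω), |(kop κ)^[t] g x - ∫ y, g y ∂π| ≤ 2 * Cg * (A * ρ ^ t))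
    (hρ0 : 0 ≤ ρ) (hρ1 : ρ < 1) {f g : Ω → ℝ} (hf : Measurable f) (hg : Measurable g)
    {Cf Cg : ℝ} (hCf : ∀ x, |f x| ≤ Cf) (hCg : ∀ x, |g x| ≤ Cg) (u v : ℝ) :
    (∫ y, ((u * f y + v * g y) - ∫ z, (u * f z + v * g z) ∂π) ^ 2 ∂π)
        + 2 * ∑' k, ∫ y, ((u * f y + v * g y) - ∫ z, (u * f z + v * g z) ∂π)
          * (kop κ)^[k + 1] (fun y => (u * f y + v * g y) - ∫ z, (u * f z + v * g z) ∂π) y ∂π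
      = u ^ 2 * ((∫ y, (f y - ∫ z, f z ∂π) ^ 2 ∂π)
            + 2 * ∑' k, ∫ y, (f y - ∫ z, f z ∂π) * (kop κ)^[k + 1] (fun y => f y - ∫ z, f z ∂π) y ∂π)
        + 2 * (u * v) * ((∫ y, (f y - ∫ z, f z ∂π) * (g y - ∫ z, g z ∂π) ∂π)
            + ∑' k, ((∫ y, (f y - ∫ z, f z ∂π) * (kop κ)^[k + 1] (fun y => g y - ∫ z, g z ∂π) y ∂π)
              + ∫ y, (g y - ∫ z, g z ∂π) * (kop κ)^[k + 1] (fun y => f y - ∫ z, f z ∂π) y ∂π))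
        + v ^ 2 * ((∫ y, (g y - ∫ z, g z ∂π) ^ 2 ∂π)
            + 2 * ∑' k, ∫ y, (g y - ∫ z, g z ∂π)
              * (kop κ)^[k + 1] (fun y => g y - ∫ z, g z ∂π) y ∂π) :=
  greenKubo_lincomb_eq κ π hf hg hCf hCg
    (summable_crossAutocov_of_envelope henv hρ0 hρ1 hf hf hCf hCf)
    (summable_crossAutocov_of_envelope henv hρ0 hρ1 hg hg hCg hCg)
    (summable_crossAutocov_of_envelope henv hρ0 hρ1 hf hg hCf hCg)
    (summable_crossAutocov_of_envelope henv hρ0 hρ1 hg hf hCg hCf) u v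

/-- **POLARIZATION under the envelope**: `¼ (σ²_{f+g} − σ²_{f−g}) = σ_{fg}`. -/
theorem greenKuboCross_eq_polarization_of_envelope
    (henv : ∀ (g : Ω → ℝ), Measurable g → ∀ (Cg : ℝ), (∀ x, |g x| ≤ Cg) →
      ∀ (t : ℕ) (x : Ω), |(kop κ)^[t] g x - ∫ y, g y ∂π| ≤ 2 * Cg * (A * ρ ^ t))
    (hρ0 : 0 ≤ ρ) (hρ1 : ρ < 1) {f g : Ω → ℝ} (hf : Measurable f) (hg : Measurable g)
    {Cf Cg : ℝ} (hCf : ∀ x, |f x| ≤ Cf) (hCg : ∀ x, |g x| ≤ Cg) :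
    (1 / 4 : ℝ) * (((∫ y, ((f y + g y) - ∫ z, (f z + g z) ∂π) ^ 2 ∂π)
          + 2 * ∑' k, ∫ y, ((f y + g y) - ∫ z, (f z + g z) ∂π)
            * (kop κ)^[k + 1] (fun y => (f y + g y) - ∫ z, (f z + g z) ∂π) y ∂π)
        - ((∫ y, ((f y - g y) - ∫ z, (f z - g z) ∂π) ^ 2 ∂π)
          + 2 * ∑' k, ∫ y, ((f y - g y) - ∫ z, (f z - g z) ∂π)
            * (kop κ)^[k + 1] (fun y => (f y - g y) - ∫ z, (f z - g z) ∂π) y ∂π))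
      = (∫ y, (f y - ∫ z, f z ∂π) * (g y - ∫ z, g z ∂π) ∂π)
        + ∑' k, ((∫ y, (f y - ∫ z, f z ∂π) * (kop κ)^[k + 1] (fun y => g y - ∫ z, g z ∂π) y ∂π)
          + ∫ y, (g y - ∫ z, g z ∂π) * (kop κ)^[k + 1] (fun y => f y - ∫ z, f z ∂π) y ∂π) :=
  greenKuboCross_eq_polarization κ π hf hg hCf hCg
    (summable_crossAutocov_of_envelope henv hρ0 hρ1 hf hf hCf hCf)
    (summable_crossAutocov_of_envelope henv hρ0 hρ1 hg hg hCg hCg)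
    (summable_crossAutocov_of_envelope henv hρ0 hρ1 hf hg hCf hCg)
    (summable_crossAutocov_of_envelope henv hρ0 hρ1 hg hf hCg hCf)

/-- **THE LONG-RUN COVARIANCE MATRIX IS POSITIVE SEMIDEFINITE**: `π` invariant, the envelope with
`0 ≤ ρ < 1`, `f, g` bounded measurable ⇒ `σ_{fg}² ≤ σ²_f · σ²_g` (from `σ²_{uf+g} ≥ 0` for every real
`u`, a nonnegative quadratic in `u`, and the discriminant). -/
theorem greenKuboCross_sq_le_of_envelope (hπ : Kernel.Invariant κ π)
    (henv : ∀ (g : Ω → ℝ), Measurable g → ∀ (Cg : ℝ), (∀ x, |g x| ≤ Cg) →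
      ∀ (t : ℕ) (x : Ω), |(kop κ)^[t] g x - ∫ y, g y ∂π| ≤ 2 * Cg * (A * ρ ^ t))
    (hρ0 : 0 ≤ ρ) (hρ1 : ρ < 1) {f g : Ω → ℝ} (hf : Measurable f) (hg : Measurable g)
    {Cf Cg : ℝ} (hCf : ∀ x, |f x| ≤ Cf) (hCg : ∀ x, |g x| ≤ Cg) :
    ((∫ y, (f y - ∫ z, f z ∂π) * (g y - ∫ z, g z ∂π) ∂π)
        + ∑' k, ((∫ y, (f y - ∫ z, f z ∂π) * (kop κ)^[k + 1] (fun y => g y - ∫ z, g z ∂π) y ∂π)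
          + ∫ y, (g y - ∫ z, g z ∂π) * (kop κ)^[k + 1] (fun y => f y - ∫ z, f z ∂π) y ∂π)) ^ 2
      ≤ ((∫ y, (f y - ∫ z, f z ∂π) ^ 2 ∂π)
            + 2 * ∑' k, ∫ y, (f y - ∫ z, f z ∂π) * (kop κ)^[k + 1] (fun y => f y - ∫ z, f z ∂π) y ∂π)
        * ((∫ y, (g y - ∫ z, g z ∂π) ^ 2 ∂π)
            + 2 * ∑' k, ∫ y, (g y - ∫ z, g z ∂π)
              * (kop κ)^[k + 1] (fun y => g y - ∫ z, g z ∂π) y ∂π) := by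
  set σf := (∫ y, (f y - ∫ z, f z ∂π) ^ 2 ∂π)
      + 2 * ∑' k, ∫ y, (f y - ∫ z, f z ∂π) * (kop κ)^[k + 1] (fun y => f y - ∫ z, f z ∂π) y ∂π
    with hσf
  set σg := (∫ y, (g y - ∫ z, g z ∂π) ^ 2 ∂π)
      + 2 * ∑' k, ∫ y, (g y - ∫ z, g z ∂π) * (kop κ)^[k + 1] (fun y => g y - ∫ z, g z ∂π) y ∂π
    with hσg
  set σfg := (∫ y, (f y - ∫ z, f z ∂π) * (g y - ∫ z, g z ∂π) ∂π)
      + ∑' k, ((∫ y, (f y - ∫ z, f z ∂π) * (kop κ)^[k + 1] (fun y => g y - ∫ z, g z ∂π) y ∂π)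
        + ∫ y, (g y - ∫ z, g z ∂π) * (kop κ)^[k + 1] (fun y => f y - ∫ z, f z ∂π) y ∂π)
    with hσfg
  -- `σ²_{u f + 1·g} = σf u² + 2 σfg u + σg ≥ 0` for every `u`
  have hquad : ∀ u : ℝ, 0 ≤ σf * (u * u) + 2 * σfg * u + σg := by
    intro u
    have hb : ∀ y, |u * f y + 1 * g y| ≤ |u| * Cf + Cg := fun y => by
      refine (abs_add_le _ _).trans (add_le_add ?_ (by rw [one_mul]; exact hCg y))
      rw [abs_mul]; exact mul_le_mul_of_nonneg_left (hCf y) (abs_nonneg u)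
    have hm : Measurable fun y => u * f y + 1 * g y := (hf.const_mul u).add (hg.const_mul 1)
    have h0 := greenKubo_nonneg_of_envelope hπ henv hρ0 hρ1 hm hb
    rw [greenKubo_lincomb_eq_of_envelope henv hρ0 hρ1 hf hg hCf hCg u 1] at h0
    rw [← hσf, ← hσg, ← hσfg] at h0
    nlinarith [h0]
  have hdisc := discrim_le_zero hquad
  rw [discrim] at hdisc
  nlinarith [hdisc]

end Envelope

end Summit.Ventures.LatticeQCDFlow.Scoring

end
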